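import Mathlib.Analysis.SpecialFunctions.Gaussian.GaussianIntegral
import Literature.NumberTheory.Transcendental.FischlerRivoalCorollary1
import Literature.NumberTheory.Transcendental.BinomialAntiEFunction
import HarnessLib

/-!
# Fischler–Rivoal's Corollary 1 — the PROVED parts of its printed proof (§5.2): summation of the binomial Э-function at `1/α`, real forms, unconditional Э-values, and what the corollary gives the Schanuel route

`Literature/NumberTheory/Transcendental/FischlerRivoalCorollary1Proofs.lean` — sibling proofs file
of `Literature/NumberTheory/Transcendental/FischlerRivoalCorollary1.lean` (the named fact
`FischlerRivoal2024_corollary1` = [FischlerRivoal2024, Corollary 1]: Conjecture 2 ⟹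
`∫₀^∞ (t+α)^s e^{−t} dt ∉ ℚ̄` for `α ∈ ℚ̄`, `α > 0`, `s ∈ ℚ ∖ ℤ_{≥0}`). No definition, no named
fact; everything here is a theorem.

The printed proof (§5.2, verified on the page): "The Э-function `𝔣(z) := ∑ s(s−1)⋯(s−n+1) zⁿ`
is solution of the inhomogeneous differential equation `z²𝔣′(z) + (1−sz)𝔣(z) − 1 = 0` … vector
of Э-functions `ᵗ(1, 𝔣(z))`. The coefficients of the matrix have only `0` as pole. Moreover,
`𝔣(z)` is a transcendental function because `s ∉ ℤ_{≥0}`. Hence, by Theorem 3, `𝔣₀(1/α) ∉ ℚ̄`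
when `α ∈ ℚ̄`, `α > 0`, because `0` is not an anti-Stokes direction of `𝔣(z)`. It remains to
observe that this `1`-sommation is `∫₀^∞ (1+tz)^s e^{−t} dt`."  What is PROVED here:

* §1 `isBorelLaplaceSum_binomial_all` / `isAntiESum_binomial_all` — "`0` is not anti-Stokes" and
  "this `1`-summation is `∫₀^∞ (1 + t/x)^s e^{−t} dt`" for EVERY `s ∈ ℂ` and `x > 0` (the tree's
  `isBorelLaplaceSum_binomial` had `Re s ≤ 0`; for `Re s > 0` the Laplace integrand
  `e^{−xr}(1+r)^{Re s}` is dominated by `2^σ(e^{−xr} + r^σ e^{−xr})`).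
* §2 `IsBorelLaplaceSum.rescale_one`, `isAntiESum_chooseSeq_inv_one` — the evaluation at `1/α`
  moved to the point `1` of Conjecture 2: `𝔣(z/α) = ∑ n! C(s,n)α^{−n} zⁿ` (coefficients
  `chooseSeq s α⁻¹`, a strict `E`-sequence by `BinomialAntiEFunction.lean`) has `1`-sum
  `∫₀^∞ e^{−t}(1+t/α)^s dt` at `z = 1` [FischlerRivoal2018, §4.3: "`𝔣̃(x) = 𝔣(ξx)` …
  `𝔣̃₀(1) = 𝔣_θ(ξ)`"].
* §3 `integral_one_add_div_cpow_mem_antiEValues` — UNCONDITIONALLY `∫₀^∞ e^{−t}(1+t/α)^s dt ∈ 𝐃`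
  for all `s ∈ ℚ` and real algebraic `α > 0`.
* §4 real forms: `∫₀^∞ (t+α)^s e^{−t} dt = α^s ∫₀^∞ e^{−t}(1+t/α)^s dt`; the complex Laplace
  integral is the real one; `J = ∫₀^∞ e^{−x}/√(1+x) dx` (`α = 1`, `s = −1/2`) and Gompertz's
  `δ = ∫₀^∞ e^{−x}/(1+x) dx` (`s = −1`) as instances; `J ∈ 𝐃` and `δ ∈ 𝐃` as real numbers
  (`ofReal_integral_exp_neg_div_sqrt_mem_antiEValues` — the Э-membership the route
  `Summits/Schanuel/Schanuel/Theses/GaussianStokesSector.lean` asks of the Literature side —,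
  `ofReal_gompertz_mem_antiEValues`).
* §5 the conditional plumbing for the dependents: from the fact and its antecedent,
  `Transcendental ℚ J` (literally the route's `AntiEValueTranscendental`) and
  `Transcendental ℚ δ` — the two hypotheses stay EXPLICIT (nothing is discharged here).

NOT here (the named-fact debt itself): Theorem 3 of the source for the system `ᵗ(1, 𝔣)`, i.e.
Beukers' method for Э-functions [FischlerRivoal2024, §5.1, Proposition 4], whose engine is
André's structure theorem for `E`-operators (non-trivial singularities only at `0`, `∞`; duality
with Э-series at infinity) [Andre2000GevreyI] — not in the tree.

## References

* [FischlerRivoal2024] S. Fischler, T. Rivoal, J. Number Theory 261 (2024), §1 Corollary 1,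
  §5.2 (proof), §5.1 (Proposition 4).
* [FischlerRivoal2018] S. Fischler, T. Rivoal, Amer. J. Math. 140 (2018), §4.3.
* [Andre2000GevreyI] Y. André, Ann. of Math. 151 (2000), 705–740.
-/

noncomputable section

open Complex MeasureTheory Set Filter Real
open scoped Nat Topology

namespace Literature.NumberTheory.Transcendental

open Literature.Barriers.Schanuel Literature.RingTheory.Binomial

/-! ### 1. The Laplace integral of `(1+ξ)^s` converges for every `s` -/

/-- `(1 + r)^σ ≤ 2^σ (1 + r^σ)` for `r ≥ 0`, `σ ≥ 0`. [folklore] -/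
theorem one_add_rpow_le_two_rpow_mul {r σ : ℝ} (hr : 0 ≤ r) (hσ : 0 ≤ σ) :
    (1 + r) ^ σ ≤ (2 : ℝ) ^ σ * (1 + r ^ σ) := by
  rcases le_total r 1 with h | h
  · calc (1 + r) ^ σ ≤ (2 : ℝ) ^ σ := Real.rpow_le_rpow (by linarith) (by linarith) hσ
      _ ≤ (2 : ℝ) ^ σ * (1 + r ^ σ) := by
        have : 0 ≤ r ^ σ := Real.rpow_nonneg hr σ
        have h2 : 0 ≤ (2 : ℝ) ^ σ := Real.rpow_nonneg (by norm_num) σ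
        nlinarith
  · calc (1 + r) ^ σ ≤ (2 * r) ^ σ := Real.rpow_le_rpow (by linarith) (by linarith) hσ
      _ = (2 : ℝ) ^ σ * r ^ σ := Real.mul_rpow (by norm_num) hr
      _ ≤ (2 : ℝ) ^ σ * (1 + r ^ σ) := by
        have h2 : 0 ≤ (2 : ℝ) ^ σ := Real.rpow_nonneg (by norm_num) σ
        nlinarith [Real.rpow_nonneg hr σ]

/-- For `x > 0` and every real `σ`, `r ↦ e^{−xr} (1+r)^σ` is integrable on `(0, ∞)`. [folklore] -/
theorem integrableOn_exp_neg_mul_mul_one_add_rpow {x : ℝ} (hx : 0 < x) (σ : ℝ) :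
    IntegrableOn (fun r : ℝ => Real.exp (-x * r) * (1 + r) ^ σ) (Ioi 0) := by
  set τ : ℝ := max σ 0 with hτ
  have hτ0 : 0 ≤ τ := le_max_right _ _
  -- dominating function `2^τ (e^{-xr} + r^τ e^{-xr})`
  have hdom : IntegrableOn (fun r : ℝ => (2 : ℝ) ^ τ * (Real.exp (-x * r) + r ^ τ * Real.exp (-x * r)))
      (Ioi 0) := by
    refine Integrable.const_mul (Integrable.add ?_ ?_) _
    · exact exp_neg_integrableOn_Ioi 0 hx
    · have := integrableOn_rpow_mul_exp_neg_mul_rpow (s := τ) (p := 1) (b := x)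
        (by linarith) le_rfl hx
      refine this.congr_fun (fun r _ => ?_) measurableSet_Ioi
      simp [Real.rpow_one]
  have hmeas : AEStronglyMeasurable (fun r : ℝ => Real.exp (-x * r) * (1 + r) ^ σ)
      (volume.restrict (Ioi 0)) := by
    refine ContinuousOn.aestronglyMeasurable (fun r hr => ?_) measurableSet_Ioi
    have h1r : 0 < 1 + r := by linarith [mem_Ioi.1 hr]
    exact ((by fun_prop : ContinuousAt (fun r : ℝ => Real.exp (-x * r)) r).mul
      ((continuousAt_const.add continuousAt_id).rpow_const (Or.inl h1r.ne'))).continuousWithinAt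
  refine Integrable.mono' hdom hmeas ?_
  refine (ae_restrict_iff' measurableSet_Ioi).2 (Eventually.of_forall fun r hr => ?_)
  have hr0 : 0 ≤ r := le_of_lt (mem_Ioi.1 hr)
  have h1r : 0 < 1 + r := by linarith
  rw [norm_mul, Real.norm_eq_abs, Real.norm_eq_abs, abs_of_pos (Real.exp_pos _),
    abs_of_pos (Real.rpow_pos_of_pos h1r σ)]
  have hστ : (1 + r) ^ σ ≤ (1 + r) ^ τ :=
    Real.rpow_le_rpow_of_exponent_le (by linarith) (le_max_left _ _)
  have hexp : 0 < Real.exp (-x * r) := Real.exp_pos _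
  calc Real.exp (-x * r) * (1 + r) ^ σ ≤ Real.exp (-x * r) * ((2 : ℝ) ^ τ * (1 + r ^ τ)) := by
        gcongr
        exact hστ.trans (one_add_rpow_le_two_rpow_mul hr0 hτ0)
    _ = (2 : ℝ) ^ τ * (Real.exp (-x * r) + r ^ τ * Real.exp (-x * r)) := by ring

/-- **"This `1`-summation is `∫₀^∞ (1 + t/x)^s e^{−t} dt`" for EVERY `s ∈ ℂ`**: for real `x > 0`
the Э-series `𝔣(1/x)`, `𝔣 = ∑ n!·C(s,n) zⁿ`, is Borel–Laplace summable along the positive real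
axis with sum `∫₀^∞ e^{−t}(1 + t/x)^s dt` (the Laplace integral `x∫₀^∞ e^{−xξ}(1+ξ)^s dξ`
converges absolutely since `|(1+ξ)^s| = (1+ξ)^{Re s}`). Extends `isBorelLaplaceSum_binomial`
(`Re s ≤ 0`) of `AntiEFunction.lean`. PROVED. [cite: FischlerRivoal2024, §5.2] -/
theorem isBorelLaplaceSum_binomial_all (s : ℂ) {x : ℝ} (hx : 0 < x) :
    IsBorelLaplaceSum (fun n => Ring.choose s n) 0 x
      (∫ t in Ioi (0 : ℝ), cexp (-(t : ℂ)) * (1 + (t : ℂ) / x) ^ s) := by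
  have hd : (0 : ℝ) ∈ Ioo (-Real.pi) Real.pi := ⟨by linarith [Real.pi_pos], Real.pi_pos⟩
  refine ⟨fun ξ => (1 + ξ) ^ s, isBorelRayContinuation_one_add_cpow s hd, ?_, ?_⟩
  · have hint_eq : antiELaplaceIntegrand (fun ξ => (1 + ξ) ^ s) 0 x =
        fun r : ℝ => cexp (-x * (r : ℂ)) * (1 + (r : ℂ)) ^ s := by
      funext r
      simp only [antiELaplaceIntegrand, Complex.ofReal_zero, zero_mul, Complex.exp_zero, one_mul,
        mul_one]
      ring_nf
    rw [hint_eq]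
    have hmeas : AEStronglyMeasurable (fun r : ℝ => cexp (-x * (r : ℂ)) * (1 + (r : ℂ)) ^ s)
        (volume.restrict (Ioi 0)) := by
      refine ContinuousOn.aestronglyMeasurable (fun r hr => ?_) measurableSet_Ioi
      refine ContinuousAt.continuousWithinAt ?_
      refine ContinuousAt.mul (by fun_prop) ?_
      refine ContinuousAt.cpow (by fun_prop) continuousAt_const ?_
      have : (1 + (r : ℂ)) = ((1 + r : ℝ) : ℂ) := by push_cast; ring
      rw [this, Complex.ofReal_mem_slitPlane]
      linarith [mem_Ioi.1 hr]
    refine Integrable.mono' (integrableOn_exp_neg_mul_mul_one_add_rpow hx s.re) hmeas ?_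
    refine (ae_restrict_iff' measurableSet_Ioi).2 (Eventually.of_forall fun r hr => ?_)
    have h1r : 0 < 1 + r := by linarith [mem_Ioi.1 hr]
    rw [norm_mul, Complex.norm_exp]
    have hre : (-(x : ℂ) * (r : ℂ)).re = -x * r := by
      simp [Complex.mul_re]
    have hcpow : ‖(1 + (r : ℂ)) ^ s‖ = (1 + r) ^ s.re := by
      have : (1 + (r : ℂ)) = ((1 + r : ℝ) : ℂ) := by push_cast; ring
      rw [this, Complex.norm_cpow_eq_rpow_re_of_pos h1r]
    rw [hre, hcpow]
  · rw [antiELaplace_zero_ofReal _ hx]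

/-- The same in the [FischlerRivoal2024] labelling: `𝔣₀(1/x) = ∫₀^∞ e^{−t}(1 + t/x)^s dt` for every
`s ∈ ℂ` and `x > 0`. PROVED. [cite: FischlerRivoal2024, §5.2] -/
theorem isAntiESum_binomial_all (s : ℂ) {x : ℝ} (hx : 0 < x) :
    IsAntiESum (fun n => Ring.choose s n) 0 x
      (∫ t in Ioi (0 : ℝ), cexp (-(t : ℂ)) * (1 + (t : ℂ) / x) ^ s) :=
  (isAntiESum_zero_iff _ _ _).2 (isBorelLaplaceSum_binomial_all s hx)

/-! ### 2. Rescaling the evaluation point to `z = 1` -/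

/-- **Rescaling** ("letting `𝔣̃(x) = 𝔣(ξx)` we have `𝔣̃₀(1) = 𝔣_θ(ξ)`", here for real `ξ = x > 0`,
where no rotation of the Borel ray is needed): if `𝔣_a(1/z)` is Borel–Laplace summable along the
positive real axis at `z = x` with sum `w`, then the rescaled Э-series `𝔣_a(z/x) = ∑ n! aₙx^{−n} zⁿ`
is summable at `z = 1` with the same sum (its Borel transform is `G(ξ/x)`). PROVED.
[cite: FischlerRivoal2018, §4.3] -/
theorem IsBorelLaplaceSum.rescale_one {a : ℕ → ℂ} {x : ℝ} (hx : 0 < x) {w : ℂ}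
    (h : IsBorelLaplaceSum a 0 x w) :
    IsBorelLaplaceSum (fun n => a n * ((x : ℂ)⁻¹) ^ n) 0 1 w := by
  obtain ⟨G, ⟨⟨U, hU, hRU, hGU⟩, hsum⟩, hint, rfl⟩ := h
  have hx0 : (x : ℂ) ≠ 0 := by exact_mod_cast hx.ne'
  -- the rescaled continuation `ξ ↦ G (ξ / x)`
  set G' : ℂ → ℂ := fun ξ => G (ξ / x) with hG'
  have hcont : IsBorelRayContinuation (fun n => a n * ((x : ℂ)⁻¹) ^ n) 0 G' := by
    refine ⟨⟨(fun ξ : ℂ => ξ / x) ⁻¹' U, hU.preimage (by fun_prop), ?_, ?_⟩, ?_⟩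
    · rintro _ ⟨r, hr, rfl⟩
      refine hRU ⟨r / x, div_nonneg hr hx.le, ?_⟩
      simp only [Complex.ofReal_zero, zero_mul, Complex.exp_zero, mul_one]
      push_cast
      rfl
    · intro ξ hξ
      exact (hGU _ hξ).comp ξ ((differentiableWithinAt_id (𝕜 := ℂ)).div_const (x : ℂ))
        (fun y hy => hy)
    · -- near `0`, `G(ξ/x) = ∑ aₙ (ξ/x)ⁿ = ∑ (aₙ x⁻ⁿ) ξⁿ`
      have htend : Tendsto (fun ξ : ℂ => ξ / x) (𝓝 0) (𝓝 0) := by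
        have : Continuous (fun ξ : ℂ => ξ / x) := by fun_prop
        simpa using this.tendsto 0
      filter_upwards [htend.eventually hsum] with ξ hξ
      have : (fun n => a n * ((x : ℂ)⁻¹) ^ n * ξ ^ n) = fun n => a n * (ξ / x) ^ n := by
        funext n
        rw [div_eq_mul_inv, mul_pow]
        ring
      rw [this]
      exact hξ
  have hint_eq : antiELaplaceIntegrand G' 0 1 = fun r : ℝ => cexp (-(r : ℂ)) * G (r / x) := by
    funext r
    simp only [antiELaplaceIntegrand, Complex.ofReal_zero, zero_mul, Complex.exp_zero, one_mul,
      mul_one, hG']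
  have hint_eq' : antiELaplaceIntegrand G 0 x = fun r : ℝ => cexp (-x * (r : ℂ)) * G r := by
    funext r
    simp only [antiELaplaceIntegrand, Complex.ofReal_zero, zero_mul, Complex.exp_zero, one_mul,
      mul_one]
    ring_nf
  refine ⟨G', hcont, ?_, ?_⟩
  · -- integrability by the substitution `r ↦ r / x`
    rw [hint_eq]
    rw [hint_eq'] at hint
    have := (integrableOn_Ioi_comp_mul_left_iff (fun r : ℝ => cexp (-x * (r : ℂ)) * G r) 0
      (inv_pos.2 hx)).2 (by simpa using hint)
    refine this.congr_fun (fun r _ => ?_) measurableSet_Ioi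
    simp only
    have hx0' : (x : ℂ) ≠ 0 := hx0
    push_cast
    field_simp
  · rw [antiELaplace_zero_ofReal _ hx, antiELaplace, one_mul, hint_eq]

/-- **`𝔣̃₀(1) = 𝔣₀(1/α)` for the binomial Э-function**: with `aₙ = C(s,n) α^{−n}`
(`chooseSeq s α⁻¹`), the Э-series `∑ n! C(s,n) α^{−n} zⁿ = 𝔣(z/α)` is `1`-summable in the direction
`0` at `z = 1` with sum `∫₀^∞ e^{−t}(1 + t/α)^s dt` (`s ∈ ℚ`, `α > 0`). This is the hypothesis
shape of Conjecture 2 (`𝔣_θ(1)`) for the function to which [FischlerRivoal2024, §5.2] applies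
Theorem 3. PROVED. [cite: FischlerRivoal2024, §5.2] -/
theorem isAntiESum_chooseSeq_inv_one (s : ℚ) {α : ℝ} (hα : 0 < α) :
    IsAntiESum (chooseSeq s ((α : ℂ)⁻¹)) 0 1
      (∫ t in Ioi (0 : ℝ), cexp (-(t : ℂ)) * (1 + (t : ℂ) / α) ^ (s : ℂ)) := by
  rw [isAntiESum_zero_iff]
  exact (isBorelLaplaceSum_binomial_all (s : ℂ) hα).rescale_one hα

/-! ### 3. Unconditional Э-values at `1/α` -/

/-- **`∫₀^∞ e^{−t}(1 + t/α)^s dt ∈ 𝐃`** for every `s ∈ ℚ` and every real algebraic `α > 0`,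
UNCONDITIONALLY (`𝔣₀(1/α)` for the Э-function `𝔣 = ∑ s(s−1)⋯(s−n+1)zⁿ`; the direction `0` is
regular). PROVED. [cite: FischlerRivoal2024, §5.2] -/
theorem integral_one_add_div_cpow_mem_antiEValues (s : ℚ) {α : ℝ} (hα : 0 < α)
    (halg : IsAlgebraic ℚ α) :
    (∫ t in Ioi (0 : ℝ), cexp (-(t : ℂ)) * (1 + (t : ℂ) / α) ^ (s : ℂ)) ∈ antiEValues := by
  refine mem_antiEValues_of_isBorelLaplaceSum_zero ?_
    ((isAntiESum_zero_iff _ _ _).1 (isAntiESum_chooseSeq_inv_one s hα))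
  refine isStrictEFunction_chooseSeq s _ ?_
  have : IsAlgebraic ℚ (α : ℂ) := by
    simpa using halg.algebraMap (A := ℂ)
  exact this.inv

/-! ### 4. Real forms of the integrals -/

/-- The complex Laplace integral is the real one: `∫₀^∞ e^{−t}(1+t/α)^s dt` (`s ∈ ℚ`, `α > 0`).
[folklore] -/
theorem integral_cexp_mul_one_add_div_cpow_eq_ofReal (s : ℚ) {α : ℝ} (hα : 0 < α) :
    (∫ t in Ioi (0 : ℝ), cexp (-(t : ℂ)) * (1 + (t : ℂ) / α) ^ (s : ℂ)) =
      ((∫ t in Ioi (0 : ℝ), Real.exp (-t) * (1 + t / α) ^ (s : ℝ) : ℝ) : ℂ) := by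
  rw [← integral_complex_ofReal]
  refine setIntegral_congr_fun measurableSet_Ioi fun t ht => ?_
  have h1 : 0 ≤ 1 + t / α := by
    have := mem_Ioi.1 ht
    positivity
  have hcast : (1 + (t : ℂ) / α) = ((1 + t / α : ℝ) : ℂ) := by push_cast; ring
  rw [hcast, show ((s : ℚ) : ℂ) = (((s : ℚ) : ℝ) : ℂ) from (Complex.ofReal_ratCast s).symm,
    ← Complex.ofReal_cpow h1]
  push_cast
  ring

/-- `∫₀^∞ (t+α)^s e^{−t} dt = α^s · ∫₀^∞ e^{−t}(1 + t/α)^s dt` for `α > 0` (the number of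
Corollary 1 versus the `1`-sum `𝔣₀(1/α)`). [cite: FischlerRivoal2024, §5.2] -/
theorem integral_add_rpow_mul_exp_neg_eq (s : ℝ) {α : ℝ} (hα : 0 < α) :
    (∫ t in Ioi (0 : ℝ), (t + α) ^ s * Real.exp (-t)) =
      α ^ s * ∫ t in Ioi (0 : ℝ), Real.exp (-t) * (1 + t / α) ^ s := by
  rw [← integral_const_mul]
  refine setIntegral_congr_fun measurableSet_Ioi fun t ht => ?_
  have ht0 : 0 ≤ t := le_of_lt (mem_Ioi.1 ht)
  have h1 : 0 ≤ 1 + t / α := by positivity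
  have : t + α = α * (1 + t / α) := by field_simp; ring
  rw [this, Real.mul_rpow hα.le h1]
  ring

/-- The route's number `J = ∫₀^∞ e^{−x}/√(1+x) dx` is the instance `α = 1`, `s = −1/2` of the number
`∫₀^∞ (t+α)^s e^{−t} dt` of Corollary 1. [folklore] -/
theorem integral_exp_neg_div_sqrt_eq :
    (∫ x in Ioi (0 : ℝ), Real.exp (-x) / Real.sqrt (1 + x)) =
      ∫ t in Ioi (0 : ℝ), (t + (1 : ℝ)) ^ (((-1 / 2 : ℚ)) : ℝ) * Real.exp (-t) := by
  refine setIntegral_congr_fun measurableSet_Ioi fun t ht => ?_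
  have ht1 : 0 ≤ t + 1 := by linarith [mem_Ioi.1 ht]
  rw [show (((-1 / 2 : ℚ)) : ℝ) = -(1 / 2 : ℝ) by push_cast; ring, Real.rpow_neg ht1,
    ← Real.sqrt_eq_rpow, add_comm t 1, div_eq_mul_inv, mul_comm]

/-- Gompertz's constant `δ = ∫₀^∞ e^{−x}/(1+x) dx` is the instance `α = 1`, `s = −1`. [folklore] -/
theorem integral_exp_neg_div_one_add_eq :
    (∫ x in Ioi (0 : ℝ), Real.exp (-x) / (1 + x)) =
      ∫ t in Ioi (0 : ℝ), (t + (1 : ℝ)) ^ (((-1 : ℚ)) : ℝ) * Real.exp (-t) := by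
  refine setIntegral_congr_fun measurableSet_Ioi fun t ht => ?_
  have ht1 : 0 ≤ t + 1 := by linarith [mem_Ioi.1 ht]
  rw [show (((-1 : ℚ)) : ℝ) = -(1 : ℝ) by push_cast; ring, Real.rpow_neg ht1, Real.rpow_one,
    add_comm t 1, div_eq_mul_inv, mul_comm]

/-- **`J = ∫₀^∞ e^{−x}/√(1+x) dx ∈ 𝐃` (as a real number, unconditionally)** — the Э-membership of
the number of `Summit.Schanuel.Schanuel.Theses.GaussianStokesSector.AntiEValueTranscendental`
(formerly the route's support item `GaussianAntiEValue`): `J = 𝔣₀(1)` for the Э-function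
`∑ n! C(−1/2, n) zⁿ`. PROVED. [cite: FischlerRivoal2024, §5.2] -/
theorem ofReal_integral_exp_neg_div_sqrt_mem_antiEValues :
    ((∫ x in Ioi (0 : ℝ), Real.exp (-x) / Real.sqrt (1 + x) : ℝ) : ℂ) ∈ antiEValues := by
  rw [integral_exp_neg_div_sqrt_eq, integral_add_rpow_mul_exp_neg_eq _ one_pos, Real.one_rpow,
    one_mul]
  have h := integral_one_add_div_cpow_mem_antiEValues (-1 / 2 : ℚ) one_pos isAlgebraic_one
  rw [integral_cexp_mul_one_add_div_cpow_eq_ofReal (-1 / 2 : ℚ) one_pos] at h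
  simpa using h

/-- **Gompertz's constant `δ ∈ 𝐃` (real form).** PROVED. [cite: FischlerRivoal2018, §4.3] -/
theorem ofReal_gompertz_mem_antiEValues :
    ((∫ x in Ioi (0 : ℝ), Real.exp (-x) / (1 + x) : ℝ) : ℂ) ∈ antiEValues := by
  rw [integral_exp_neg_div_one_add_eq, integral_add_rpow_mul_exp_neg_eq _ one_pos, Real.one_rpow,
    one_mul]
  have h := integral_one_add_div_cpow_mem_antiEValues (-1 : ℚ) one_pos isAlgebraic_one
  rw [integral_cexp_mul_one_add_div_cpow_eq_ofReal (-1 : ℚ) one_pos] at h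
  simpa using h

/-! ### 5. What Corollary 1 gives the Schanuel route (conditional plumbing) -/

/-- **Corollary 1 ⟹ the route's Э-rung**: under the named fact `FischlerRivoal2024_corollary1`
and its antecedent (Fischler–Rivoal's Conjecture 2, verbatim), the number
`J = ∫₀^∞ e^{−x}/√(1+x) dx` of
`Summit.Schanuel.Schanuel.Theses.GaussianStokesSector.AntiEValueTranscendental` is transcendental
(instance `α = 1`, `s = −1/2 ∉ ℤ_{≥0}`). PROVED (the deduction; both hypotheses stay explicit).
[cite: FischlerRivoal2024, Corollary 1 (§1, p. 4)] -/
theorem FischlerRivoal2024_corollary1.transcendental_integral_exp_neg_div_sqrt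
    (h : FischlerRivoal2024_corollary1)
    (hC2 : ∀ (a : ℕ → ℂ), IsStrictEFunction a →
      ∀ θ : ℝ, θ ∈ Ioo (-(Real.pi / 2)) (Real.pi / 2) → IsAntiESum a θ 1 0 →
        ∃ g : PowerSeries ℂ, IsAntiEFunction g ∧ (PowerSeries.X - 1) * g = antiESeries a) :
    Transcendental ℚ (∫ x in Ioi (0 : ℝ), Real.exp (-x) / Real.sqrt (1 + x)) := by
  rw [integral_exp_neg_div_sqrt_eq]
  refine h hC2 1 isAlgebraic_one one_pos (-1 / 2) fun n => ?_
  have : ((-1 / 2 : ℚ)) < 0 := by norm_num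
  intro heq
  have h0 : (0 : ℚ) ≤ n := Nat.cast_nonneg n
  linarith [heq ▸ this]

/-- **Corollary 1 ⟹ Gompertz's constant is transcendental** ("In particular, Gompertz's constant
`δ := ∫₀^∞ e^{−t}/(t+1) dt` is a transcendental number"), under the same two explicit hypotheses
(instance `α = 1`, `s = −1`). PROVED (the deduction). [cite: FischlerRivoal2024, Corollary 1 (§1, p. 4)] -/
theorem FischlerRivoal2024_corollary1.transcendental_gompertz
    (h : FischlerRivoal2024_corollary1)
    (hC2 : ∀ (a : ℕ → ℂ), IsStrictEFunction a →
      ∀ θ : ℝ, θ ∈ Ioo (-(Real.pi / 2)) (Real.pi / 2) → IsAntiESum a θ 1 0 →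
        ∃ g : PowerSeries ℂ, IsAntiEFunction g ∧ (PowerSeries.X - 1) * g = antiESeries a) :
    Transcendental ℚ (∫ x in Ioi (0 : ℝ), Real.exp (-x) / (1 + x)) := by
  rw [integral_exp_neg_div_one_add_eq]
  refine h hC2 1 isAlgebraic_one one_pos (-1) fun n => ?_
  have : ((-1 : ℚ)) < 0 := by norm_num
  intro heq
  have h0 : (0 : ℚ) ≤ n := Nat.cast_nonneg n
  linarith [heq ▸ this]

end Literature.NumberTheory.Transcendental

end
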